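import Summits.QuantumAdvantage.QuantumAdvantage.Theorems.FlatDialSearch

/-!
# FlatDialStrings — module 4/4 of the FlatDial THEOREMS package (cell decomp-qadv, lens-3 generation 11, rev 2)

§10 THE CONVERSE OF THE TABLE READING (critic row 71: «T → T_tab is NOT proved»): a table-level `AC⁰[⊕]` SIGNER yields a string-level
`AC⁰[⊕]` language separating the slice, so `SignedExactCubicSliceANF ∉ promiseLift (AC0Mod 2)` (item 27991, `RungANonuniform` =: T) is
EQUIVALENT to «no table-level signer» (T_tab): ★ `signedSlice_not_mem_promiseLift_iff_no_signer`.  The proof inverts the literal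
projection `tables ↦ code` WITHOUT computing code positions: every code symbol is a literal of the table bits (`isProj_encode_pairOf`) and
the code is injective in the tables, hence EVERY table bit occurs as a (possibly negated) code symbol (`exists_get_codeLits_eq`) — reading it
back is one literal; code lengths are injective in the arity (`clen_injective`, from `|bin n| ≤ n` against the cubic growth of the tables), so a
string-level family knows the arity from the input length.  Consequences: ★ `signedSlice_not_mem_promiseLift_iff_no_flatReadout` (T ⟺ T′
modulo the normality side condition `N`, the node's ONE EQUIV now reaching 27991 itself) and ★ `no_finder_of_signedSlice_not_mem`
(the WEAKER piece `W` is NECESSARY for 27991 modulo `N` alone).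

Provenance: HOME/decomp-qadv-lens-3/g11/ (record NODE-g11.md, ADDENDUM rev 2).  Namespace `Summit.QuantumAdvantage.QuantumAdvantage.Theorems.FlatDial`.
Uses BY NAME: `HintDial.Automaton.{Lit, evalLit, IsProj, acRealOver_evalLit, length_encode_cubicForm}`, `TQBFEval.length_encodeNat_le`,
`ACRealOver.comp/mono/congr/toCircuit`, `acRealOver_const`, `natPoly_eval_mono`; nothing restated.  ZERO `def … : Prop`.
-/

set_option linter.dupNamespace false

noncomputable section

namespace Summit.QuantumAdvantage.QuantumAdvantage.Theorems.FlatDial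

open Finset
open Literature.Computability.Complexity
open Literature.Computability.QuantumComplexity
open Literature.Computability.MetaComplexity
open _root_.Computability (encodeNat)
open Summit.QuantumAdvantage.QuantumAdvantage.Theorems.HintDial.Automaton

/-! ## §10a Code lengths are injective in the arity -/

section Lengths

variable {n n' : ℕ}

/-- The code length of an arity-`n` pair: `2·|bin n| + 12n³ + 12n² + 6n + 16` (`boolPair` doubles the first component and adds a
2-symbol separator; each cubic table has `4n³ + 4n² + 2n + 4` symbols). -/
def clen (n : ℕ) : ℕ := 2 * (encodeNat n).length + (12 * n ^ 3 + 12 * n ^ 2 + 6 * n + 16)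

/-- Every arity-`n` code has length `clen n`. -/
theorem length_encode_pairOf (n : ℕ) (w : Fin (tabN n) → Bool) : (pairOf n w).encode.length = clen n := by
  rw [CubicANFPair.encode, length_boolPair, length_boolPair, length_encode_cubicForm, length_encode_cubicForm, pairOf_n, clen]
  ring

/-- Every instance code has length `clen` of its arity. -/
theorem length_encode_eq_clen (I : CubicANFPair) : I.encode.length = clen I.n := by
  have h := length_encode_pairOf I.n (tabOf I)
  rwa [pairOf_tabOf] at h

/-- `clen` is strictly increasing (the binary arity field has `≤ n` symbols, the tables grow cubically). -/
theorem clen_lt_clen (h : n < n') : clen n < clen n' := by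
  have e := Literature.Barriers.QuantumAdvantage.TQBFEval.length_encodeNat_le n
  have h1 : n + 1 ≤ n' := h
  have h3 : (n + 1) ^ 3 ≤ n' ^ 3 := Nat.pow_le_pow_left h1 3
  have h2 : (n + 1) ^ 2 ≤ n' ^ 2 := Nat.pow_le_pow_left h1 2
  have h4 : (n + 1) ^ 3 = n ^ 3 + 3 * n ^ 2 + 3 * n + 1 := by ring
  have h5 : (n + 1) ^ 2 = n ^ 2 + 2 * n + 1 := by ring
  unfold clen
  omega

/-- ★ Code lengths determine the arity. -/
theorem clen_injective : Function.Injective clen := by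
  intro a b h
  rcases lt_trichotomy a b with hab | hab | hab
  · exact absurd h (clen_lt_clen hab).ne
  · exact hab
  · exact absurd h (clen_lt_clen hab).ne'

/-- `n ≤ clen n`. -/
theorem le_clen (n : ℕ) : n ≤ clen n := by unfold clen; omega

/-- `tabN n = 2(n³ + 1)`. -/
theorem tabN_eq (n : ℕ) : tabN n = 2 * (n ^ 3 + 1) := by
  simp only [tabN, TabIdx, Fintype.card_prod, Fintype.card_bool, Fintype.card_option, Fintype.card_fin]
  ring

/-- The tables are shorter than the code. -/
theorem tabN_le_clen (n : ℕ) : tabN n ≤ clen n := by rw [tabN_eq]; unfold clen; omega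

end Lengths

/-! ## §10b Inverting the literal projection: every table bit is a code symbol -/

section Symbols

variable {n : ℕ}

/-- The code of an arity-`n` pair as a list of LITERALS of the table bits (a choice from `isProj_encode_pairOf`). -/
def codeLits (n : ℕ) : List (Lit (tabN n)) := Classical.choose (isProj_encode_pairOf n)

/-- The literal list spells the code. -/
theorem codeLits_spec (n : ℕ) (w : Fin (tabN n) → Bool) : (pairOf n w).encode = (codeLits n).map (evalLit w) :=
  Classical.choose_spec (isProj_encode_pairOf n) w

/-- The literal list has the code's length. -/
theorem length_codeLits (n : ℕ) : (codeLits n).length = clen n := by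
  have h := length_encode_pairOf n fun _ => false
  rwa [codeLits_spec, List.length_map] at h

/-- The table presentation is injective. -/
theorem pairOf_injective (n : ℕ) : Function.Injective (pairOf n) := by
  intro w w' h
  simp only [pairOf, CubicANFPair.mk.injEq, heq_eq_eq, true_and] at h
  obtain ⟨hF, hG⟩ := h
  funext k
  obtain ⟨⟨b, o⟩, rfl⟩ := (tabEquiv n).surjective k
  cases b with
  | false =>
    rcases o with _ | ⟨i, j, l⟩
    · exact congrArg CubicForm.const hF
    · exact congrFun (congrFun (congrFun (congrArg CubicForm.cube hF) i) j) l
  | true =>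
    rcases o with _ | ⟨i, j, l⟩
    · exact congrArg CubicForm.const hG
    · exact congrFun (congrFun (congrFun (congrArg CubicForm.cube hG) i) j) l

/-- ★ EVERY TABLE BIT OCCURS AS A CODE SYMBOL (possibly negated): otherwise flipping that bit would not change the code, contradicting
injectivity of `encode ∘ pairOf`.  No code position is ever computed. -/
theorem exists_get_codeLits_eq (n : ℕ) (k : Fin (tabN n)) :
    ∃ p : ℕ, ∃ ng : Bool, ∃ h : p < (codeLits n).length, (codeLits n).get ⟨p, h⟩ = .inr (ng, k) := by
  by_contra hne
  set w : Fin (tabN n) → Bool := fun _ => false with hw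
  set w' : Fin (tabN n) → Bool := Function.update w k true with hw'
  have hmap : (codeLits n).map (evalLit w) = (codeLits n).map (evalLit w') := by
    refine List.map_congr_left fun ℓ hℓ => ?_
    rcases ℓ with c | ⟨ng, i⟩
    · rfl
    · have hi : i ≠ k := by
        rintro rfl
        obtain ⟨j, hj⟩ := List.get_of_mem hℓ
        exact hne ⟨j, ng, j.2, hj⟩
      show xor ng (w i) = xor ng (w' i)
      rw [hw', Function.update_of_ne hi]
  have henc : (pairOf n w).encode = (pairOf n w').encode := by rw [codeLits_spec, codeLits_spec, hmap]
  have hww : w = w' := pairOf_injective n (CubicANFPair.encode_injective henc)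
  have := congrFun hww k
  rw [hw', Function.update_self] at this
  exact Bool.false_ne_true this

/-- The position of (a symbol reading) table bit `k` in the code. -/
def pos (n : ℕ) (k : Fin (tabN n)) : ℕ := Classical.choose (exists_get_codeLits_eq n k)

/-- The polarity of that symbol. -/
def pol (n : ℕ) (k : Fin (tabN n)) : Bool := Classical.choose (Classical.choose_spec (exists_get_codeLits_eq n k))

/-- The position is inside the code. -/
theorem pos_lt_length (n : ℕ) (k : Fin (tabN n)) : pos n k < (codeLits n).length :=
  (Classical.choose_spec (Classical.choose_spec (exists_get_codeLits_eq n k))).1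

/-- The position is inside the code (length `clen n`). -/
theorem pos_lt_clen (n : ℕ) (k : Fin (tabN n)) : pos n k < clen n := length_codeLits n ▸ pos_lt_length n k

/-- The symbol at the position reads bit `k` with polarity `pol`. -/
theorem get_codeLits_pos (n : ℕ) (k : Fin (tabN n)) : (codeLits n).get ⟨pos n k, pos_lt_length n k⟩ = .inr (pol n k, k) :=
  (Classical.choose_spec (Classical.choose_spec (exists_get_codeLits_eq n k))).2

/-- Extending a finite string by `0`s (total reading of a position). -/
def ext {N : ℕ} (y : Fin N → Bool) (i : ℕ) : Bool := if h : i < N then y ⟨i, h⟩ else false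

/-- ★ THE TABLE READER: bit `k` of the tables is the code symbol at `pos n k`, corrected by its polarity. -/
def rd (n : ℕ) (y : ℕ → Bool) : Fin (tabN n) → Bool := fun k => xor (pol n k) (y (pos n k))

/-- ★ Reading the code of `pairOf n w` returns the tables `w`. -/
theorem rd_ext_encode (n : ℕ) (w : Fin (tabN n) → Bool) : rd n (ext (pairOf n w).encode.get) = w := by
  funext k
  have hlt : pos n k < (pairOf n w).encode.length := by rw [length_encode_pairOf]; exact pos_lt_clen n k
  have hsym : (pairOf n w).encode.get ⟨pos n k, hlt⟩ = xor (pol n k) (w k) := by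
    rw [List.get_of_eq (codeLits_spec n w), List.get_eq_getElem, List.getElem_map]
    have h := get_codeLits_pos n k
    rw [List.get_eq_getElem] at h
    simp only [h, evalLit]
  simp only [rd, ext, dif_pos hlt, hsym, ← Bool.xor_assoc, Bool.xor_self, Bool.false_xor]

end Symbols

/-! ## §10c The string-level family and ★ THE CONVERSE -/

section Strings

variable {D : (n : ℕ) → (Fin (tabN n) → Bool) → Bool} {d : ℕ} {r : Polynomial ℕ}

open Classical in
/-- The string-level function family induced by a table-level family `D`: on inputs of a code length `clen n`, read the tables and apply
`D n`; on other lengths, reject. -/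
def strFun (D : (n : ℕ) → (Fin (tabN n) → Bool) → Bool) (N : ℕ) (y : Fin N → Bool) : Bool :=
  if h : ∃ n, clen n = N then D (Classical.choose h) (rd (Classical.choose h) (ext y)) else false

/-- ★ On a code, the string family answers what `D` answers on the tables. -/
theorem strFun_encode (D : (n : ℕ) → (Fin (tabN n) → Bool) → Bool) (n : ℕ) (w : Fin (tabN n) → Bool) :
    strFun D (pairOf n w).encode.length (pairOf n w).encode.get = D n w := by
  have h : ∃ n', clen n' = (pairOf n w).encode.length := ⟨n, (length_encode_pairOf n w).symm⟩
  rw [strFun, dif_pos h]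
  have hn : Classical.choose h = n := clen_injective ((Classical.choose_spec h).trans (length_encode_pairOf n w))
  rw [hn, rd_ext_encode]

/-- ★ The string family is `AC⁰[⊕]`: depth `d + 1`, size `r(N) + N + 1` — `D n` composed with one literal per table bit (`ACRealOver.comp`,
`acRealOver_evalLit`), the arity being determined by the input length. -/
theorem acRealOver_strFun (hD : ∀ n, ACRealOver (accBasis 2) (D n) d (r.eval n)) (N : ℕ) :
    ACRealOver (accBasis 2) (strFun D N) (d + 1) ((r + Polynomial.X + 1).eval N) := by
  by_cases h : ∃ n, clen n = N
  · have hN : clen (Classical.choose h) = N := Classical.choose_spec h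
    set n := Classical.choose h with hn
    have hlt : ∀ k : Fin (tabN n), pos n k < N := fun k => hN ▸ pos_lt_clen n k
    have hc := (hD n).comp (fun k => acRealOver_evalLit 2 (Sum.inr (pol n k, ⟨pos n k, hlt k⟩) : Lit N))
    refine (hc.mono le_rfl ?_).congr fun y => ?_
    · rw [Polynomial.eval_add, Polynomial.eval_add, Polynomial.eval_X, Polynomial.eval_one, sum_const, card_univ, Fintype.card_fin,
        smul_eq_mul, mul_one]
      exact (Nat.add_le_add (natPoly_eval_mono r ((le_clen n).trans hN.le)) ((tabN_le_clen n).trans hN.le)).trans (Nat.le_succ _)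
    · rw [strFun, dif_pos h]
      congr 1
      funext k
      show evalLit y (Sum.inr (pol n k, ⟨pos n k, hlt k⟩)) = xor (pol n k) (ext y (pos n k))
      rw [ext, dif_pos (hlt k)]
      rfl
  · refine ((acRealOver_const (acBasis_subset_accBasis 2) false).mono (Nat.le_add_left 1 d) ?_).congr fun y => ?_
    · rw [Polynomial.eval_add, Polynomial.eval_add, Polynomial.eval_X, Polynomial.eval_one]
      omega
    · rw [strFun, dif_neg h]

/-- ★ A TABLE-LEVEL SIGNER PUTS THE SLICE IN promise-`AC⁰[⊕]`: the language `{x | strFun D |x| x = 1}` is in `AC0Mod 2` (family from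
`acRealOver_strFun` via `ACRealOver.toCircuit`) and separates the yes-codes from the no-codes (`strFun_encode` + the signer property). -/
theorem mem_promiseLift_of_signer (hr : D ∈ realisable) (hs : D ∈ signers) :
    SignedExactCubicSliceANF ∈ promiseLift (AC0Mod 2) := by
  obtain ⟨d, r, hD⟩ := hr
  choose C hC using fun N => (acRealOver_strFun hD N).toCircuit
  have key : ∀ I : CubicANFPair, strFun D I.encode.length I.encode.get = D I.n (tabOf I) := fun I => by
    have h := strFun_encode D I.n (tabOf I)
    rwa [pairOf_tabOf] at h
  refine ⟨{x | strFun D x.length x.get = true}, ⟨d + 1, r + Polynomial.X + 1, C,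
    fun N => ⟨(hC N).1, (hC N).2.1, (hC N).2.2.1⟩, fun x => ?_⟩, ?_, ?_⟩
  · rw [(hC x.length).2.2.2 x.get]
    cases hx : strFun D x.length x.get
    · symm; exact (Set.notMem_iff_boolIndicator _ _).1 (by simp [hx])
    · symm; exact (Set.mem_iff_boolIndicator _ _).1 (by simpa using hx)
  · rintro x ⟨I, ⟨hev, hv⟩, rfl⟩
    show strFun D I.encode.length I.encode.get = true
    rw [key I]
    exact (hs I.n (tabOf I) hev).1 (by rw [pairOf_tabOf]; exact hv)
  · rintro x ⟨I, ⟨hev, hv⟩, rfl⟩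
    show ¬ strFun D I.encode.length I.encode.get = true
    rw [key I, (hs I.n (tabOf I) hev).2 (by rw [pairOf_tabOf]; exact hv)]
    exact Bool.false_ne_true

/-- ★★ THE CONVERSE OF THE TABLE READING (T → T_tab): if the signed exact cubic slice is not in promise-`AC⁰[⊕]` (item 27991), then no
table-level `AC⁰[⊕]` family signs it. -/
theorem no_signer_of_signedSlice_not_mem (hT : SignedExactCubicSliceANF ∉ promiseLift (AC0Mod 2)) :
    ¬ ∃ D : (n : ℕ) → (Fin (tabN n) → Bool) → Bool, D ∈ realisable ∧ D ∈ signers :=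
  fun ⟨_, hr, hs⟩ => hT (mem_promiseLift_of_signer hr hs)

/-- ★★ T ⟺ T_tab IN KERNEL: item 27991's statement is EQUIVALENT to «no table-level `AC⁰[⊕]` signer» (the table alphabet is a faithful
presentation: `signedSlice_not_mem_promiseLift_of_no_signer` and `no_signer_of_signedSlice_not_mem`). -/
theorem signedSlice_not_mem_promiseLift_iff_no_signer :
    SignedExactCubicSliceANF ∉ promiseLift (AC0Mod 2) ↔
      ¬ ∃ D : (n : ℕ) → (Fin (tabN n) → Bool) → Bool, D ∈ realisable ∧ D ∈ signers :=
  ⟨no_signer_of_signedSlice_not_mem, signedSlice_not_mem_promiseLift_of_no_signer⟩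

/-- ★ THE NODE'S ONE EQUIV NOW REACHES 27991: modulo the normality side condition `N`, item 27991 ⟺ «no table-level `AC⁰[⊕]` family computes
the flat readout» (T ⟺ T′). -/
theorem signedSlice_not_mem_promiseLift_iff_no_flatReadout
    (hN : ∀ I : CubicANFPair, Even I.n → (I.value = 1 ∨ I.value = -1) → I.G.eval ∈ hasFlatCert I.n) :
    SignedExactCubicSliceANF ∉ promiseLift (AC0Mod 2) ↔
      ¬ ∃ D : (n : ℕ) → (Fin (tabN n) → Bool) → Bool, D ∈ realisable ∧ D ∈ flatReaders :=
  signedSlice_not_mem_promiseLift_iff_no_signer.trans (no_flatReadout_iff_no_signer hN).symm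

/-- ★ `W` IS NECESSARY FOR 27991 MODULO `N` ALONE: if the slice is not in promise-`AC⁰[⊕]` and every exact pair's `G` has a flat, then no
one-table `AC⁰[⊕]` flat finder exists. -/
theorem no_finder_of_signedSlice_not_mem
    (hN : ∀ I : CubicANFPair, Even I.n → (I.value = 1 ∨ I.value = -1) → I.G.eval ∈ hasFlatCert I.n)
    (hT : SignedExactCubicSliceANF ∉ promiseLift (AC0Mod 2)) :
    ¬ ∃ c : (n : ℕ) → (Fin (formN n) → Bool) → CertIdx n → Bool, c ∈ realisableOutG CertIdx ∧ c ∈ finders :=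
  no_finder_of_no_signer hN (no_signer_of_signedSlice_not_mem hT)

end Strings

end Summit.QuantumAdvantage.QuantumAdvantage.Theorems.FlatDial
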